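import Summits.QuantumFields.YangMills.Theorems.UnitScaleTiltProp7QprimeCombL2Defs
import HarnessLib

/-!
# Route `UnitScaleTilt`, crux K1 «MinimiserStabilityRegPr» (stmt-QuantumFields-19200) — ARCHITECTURE (A′) «HCOW-VIA-Σ», COMB slot of record (★p1 g17 WORD 21 (c) «QCOMB-L2 … + ONTO»):
# **«Q′ ONTO» ([Balaban1985BackgroundPropagators] (3.19), Thm 3.11's «obvious» clause) FOR THE PRINT-LITERAL COMB SITE AVERAGING `QprimeCombL2` ON THE MEMBER'S `L²` SPACE** —
# an explicit corner-supported preimage through the `k` comb steps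

Cell `ym3-torus` ∕ width seat `ym-ust-19200-w1` (gen 14).  THEOREMS ONLY (0 `def`, 0 `sorry`); `--supports stmt-QuantumFields-19200 --as helper`, count-neutral.
YM₃ on T³ is a ladder rung (R3), not d = 4, not infinite volume, not the Clay problem; nothing here claims the stub, the crux, `hcoS`, [B9] Thm 3.11 or the gap.

THE PRINT.  [Balaban1985BackgroundPropagators] p. 393 (3.19) «(Q′(V)λ)(y) = Σ_{x∈B(y)} L^{−d}R(V(Γ_{y,x}))λ(x) … (Q′_j(U)λ)(y) = Σ_{x∈B^j(y)} L^{−jd}R(U(Γ^{(j)}_{y,x}))λ(x)», and Thm 3.11 p. 416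
(the projection `R` and `(Q′G′²Q′*)⁻¹` need «Q′ onto», equivalently «Q′* injective» — [Balaban1984PropagatorsI] p. 25 «Q′*ω = 0, hence ω = 0»).

THE ARGUMENT (elementary; the tree's abstract one-step version is lit `B9Eq319Onto.avgQ_surjective`).  The contour `Γ_{y,x}` from the block corner `Lʲ⁺¹… ` is EMPTY at the corner,
so its transporter is `1` (`bgT L U₀ j y (blockBase L y) = 1`); hence a level-`j` function SUPPORTED ON THE CORNERS `L^{m+1}ℤᵈ` and carrying the weight `(Lᵈ)^{m+1}` is averaged by ONE comb
step to the corresponding function on the corners `L^{m}ℤᵈ` with weight `(Lᵈ)^{m}` (`Qprime_spread_succ`), whatever the transporters off the corners; iterating `k` times, the corner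
spread of any coarse function `ν` is a preimage: `Q′_k(W)(spread_k ν) = ν` (`QprimeIter_spread`).  For an `N_k`-periodic `ν` the spread is `N₀ = LᵏN_k`-periodic, so it is the based
pullback of a torus gauge parameter, and `QprimeCombL2` is ONTO the coarse torus functions (`QprimeCombL2_surjective`).

WHAT IS PROVED (ns `…Theorems.Prop7QprimeCombL2`): §1 (any `d`, `𝔸`, transporters `T` with `T j y (blockBase L y) = 1`) `blockBase_mem_blockSites`, `eq_blockBase_of_corner_mem_blockSites`,
`corner_blockBase_iff`, ★`Qprime_spread_succ`, ★★`QprimeIter_spread`, `bgT_blockBase` (the tree's comb transporters satisfy the corner hypothesis); §2 `spread_add_period` (periodicity),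
`comp_transl_descend` (a periodic `ℤ³` function is the based pullback of its torus descent), ★★★`QprimeCombL2_surjective` — «Q′ onto» for the slot of record's averaging, at EVERY background `W`
(no regularity needed), hence `adjoint`-injectivity for any Hilbert structure put on the target (lit `B11Eq103H1Complex.adjoint_injective_of_surjective`, not instantiated here).
HONEST SCOPE.  Lattice combinatorics; no estimate; Thm 3.11 ∕ 3.3 NOT proved; nothing of (A′) ∕ E′ ∕ EX ∕ the crux claimed.

References: T. Bałaban, CMP **99** (1985) 389–434 [Balaban1985BackgroundPropagators] ((3.17)–(3.19) p.393, Thm 3.11 p.416); Commun. Math. Phys. **95** (1984) 17–40 [Balaban1984PropagatorsI]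
(p.25); CMP **98** (1985) 17–51 [Balaban1985Averaging] ((2) p.17, (78)–(80) p.30).
-/

set_option autoImplicit false

noncomputable section

open scoped Matrix.Norms.L2Operator BigOperators

namespace Summit.QuantumFields.YangMills.Theorems.Prop7QprimeCombL2

open Literature.MathematicalPhysics.QuantumFieldTheory.Balaban1983to89
open Literature.MathematicalPhysics.QuantumFieldTheory.Balaban1983to89.T3ContinuumYM3Torus
open Literature.MathematicalPhysics.QuantumLattice (blockMap blockBase blockSites mem_blockSites_iff blockMap_blockBase blockMap_one blockBase_one)
open B7Prop1Explicit renaming Site → LSite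
open B7Prop1Explicit (axialFn hol_nil treeWord_zero)
open B7Eq78Linearization (Qprime QprimeIter zdBlocking conjR conjR_apply QprimeIter_succ)
open B8Eq119TwistedAxial (bgT)
open B10Eq27TorusAxialLog (transl pull)
open T4TermwiseTorus (IsPeriodic tcls tlift tcls_tlift tcls_eq_tcls_iff tcls_apply tcls_add tcls_period)
open T3SectALandauChart (bgUnits)
open B11Eq103H1Complex (SiteL2K)
open Summit.QuantumFields.YangMills.Theorems.Prop7SectET3Transport (periodsT3)
open Summit.QuantumFields.YangMills.Theorems.Prop7SectET3HilbertLetters (W₂ toL2S)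
open Summit.QuantumFields.YangMills.Theorems.Prop7SPrint (basePt)

/-! ## §1 Corner-supported functions under one comb step, and under `k` steps -/

section Spread

variable {d : ℕ} {𝔸 : Type*} [NormedRing 𝔸] [NormedAlgebra ℂ 𝔸]

/-- The corner `L·y` lies in the block `B(y)`. [cite: Balaban1985Averaging, (2) p.17] -/
theorem blockBase_mem_blockSites (L : ℕ) [NeZero L] (y : LSite d) : blockBase L y ∈ blockSites L y := by
  rw [mem_blockSites_iff, blockMap_blockBase]

/-- A site of `B(y)` which is a corner of the lattice `L^{m+1}ℤᵈ` is THE corner `L·y` of `B(y)`. [cite: Balaban1985Averaging, (2) p.17] -/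
theorem eq_blockBase_of_corner_mem_blockSites (L : ℕ) [NeZero L] (m : ℕ) {y x : LSite d} (hx : x ∈ blockSites L y)
    (hc : blockBase (L ^ (m + 1)) (blockMap (L ^ (m + 1)) x) = x) : x = blockBase L y := by
  rw [mem_blockSites_iff] at hx
  subst hx
  funext i
  have hci := congrFun hc i
  simp only [blockBase, blockMap, Nat.cast_pow] at hci ⊢
  -- `x i = L^{m+1}·q = L·(L^m·q)`, so `L ∣ x i` and `L·(x i / L) = x i`
  have hdvd : (L : ℤ) ∣ x i := ⟨(L : ℤ) ^ m * (x i / (L : ℤ) ^ (m + 1)), by rw [← mul_assoc, ← pow_succ']; exact hci.symm⟩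
  exact (Int.mul_ediv_cancel' hdvd).symm

/-- `L·y` is a corner of `L^{m+1}ℤᵈ` iff `y` is a corner of `L^{m}ℤᵈ`, and then the labels agree: `⌊L·y∕L^{m+1}⌋ = ⌊y∕L^{m}⌋`. [cite: Balaban1985Averaging, (2) p.17] -/
theorem blockMap_pow_succ_blockBase (L : ℕ) [NeZero L] (m : ℕ) (y : LSite d) :
    blockMap (L ^ (m + 1)) (blockBase L y) = blockMap (L ^ m) y := by
  funext i
  have hL : (0 : ℤ) < L := by exact_mod_cast Nat.pos_of_ne_zero (NeZero.ne L)
  simp only [blockMap, blockBase, Nat.cast_pow]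
  rw [pow_succ', Int.mul_ediv_mul_of_pos _ _ hL]

/-- The corner test for `L·y` at scale `L^{m+1}` is the corner test for `y` at scale `L^{m}`. [cite: Balaban1985Averaging, (2) p.17] -/
theorem corner_blockBase_iff (L : ℕ) [NeZero L] (m : ℕ) (y : LSite d) :
    blockBase (L ^ (m + 1)) (blockMap (L ^ (m + 1)) (blockBase L y)) = blockBase L y ↔ blockBase (L ^ m) (blockMap (L ^ m) y) = y := by
  rw [blockMap_pow_succ_blockBase]
  have hL : (L : ℤ) ≠ 0 := by exact_mod_cast NeZero.ne L
  constructor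
  · intro h
    funext i
    have hi := congrFun h i
    simp only [blockBase, Nat.cast_pow] at hi ⊢
    rw [pow_succ', mul_assoc] at hi
    exact mul_left_cancel₀ hL hi
  · intro h
    funext i
    have hi := congrFun h i
    simp only [blockBase, Nat.cast_pow] at hi ⊢
    rw [pow_succ', mul_assoc, hi]

/-- ★ **ONE COMB STEP ON A CORNER-SUPPORTED FUNCTION**: if the transporter from the corner of `B(y)` to itself is `1`, then the (3.19) average over `B(y)` (weights `L⁻ᵈ`, ANY transporters
elsewhere) of the function «`(Lᵈ)^{m+1}·ν(⌊x∕L^{m+1}⌋)` on the corners of `L^{m+1}ℤᵈ`, `0` elsewhere» is «`(Lᵈ)^{m}·ν(⌊y∕L^{m}⌋)` on the corners of `L^{m}ℤᵈ`, `0` elsewhere» at `y`: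
only the corner `x = L·y` of the block contributes. [cite: Balaban1985BackgroundPropagators, (3.19) p.393; Balaban1985Averaging, (78) p.30] -/
theorem Qprime_spread_succ (L : ℕ) [NeZero L] (m : ℕ) (Ty : LSite d → 𝔸ˣ) (y : LSite d) (hTy : Ty (blockBase L y) = 1) (ν : LSite d → 𝔸) :
    Qprime (blockSites L y) (fun _ => ((L : ℝ) ^ d)⁻¹) Ty
        (fun x => if blockBase (L ^ (m + 1)) (blockMap (L ^ (m + 1)) x) = x then (((L : ℝ) ^ d) ^ (m + 1)) • ν (blockMap (L ^ (m + 1)) x) else 0)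
      = if blockBase (L ^ m) (blockMap (L ^ m) y) = y then (((L : ℝ) ^ d) ^ m) • ν (blockMap (L ^ m) y) else 0 := by
  have hconj0 : ∀ u : 𝔸ˣ, conjR u (0 : 𝔸) = 0 := fun u => by rw [conjR_apply, mul_zero, zero_mul]
  have hLd : ((L : ℝ) ^ d) ≠ 0 := pow_ne_zero _ (by exact_mod_cast NeZero.ne L)
  rw [Qprime, Finset.sum_eq_single (blockBase L y)]
  · rw [hTy]
    by_cases hc : blockBase (L ^ m) (blockMap (L ^ m) y) = y
    · rw [if_pos ((corner_blockBase_iff L m y).2 hc), if_pos hc, blockMap_pow_succ_blockBase, conjR_apply, Units.val_one, inv_one, Units.val_one, one_mul,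
        mul_one, smul_smul, pow_succ', inv_mul_cancel_left₀ hLd]
    · rw [if_neg (fun h => hc ((corner_blockBase_iff L m y).1 h)), if_neg hc, hconj0, smul_zero]
  · intro x hx hne
    rw [if_neg (fun hc => hne (eq_blockBase_of_corner_mem_blockSites L m hx hc)), hconj0, smul_zero]
  · intro h
    exact absurd (blockBase_mem_blockSites L y) h

/-- ★★ **`k` COMB STEPS ON THE CORNER SPREAD**: for transporters equal to `1` at every block corner (`T j y (L·y) = 1`), the `j`-fold comb average ((3.19), `zdBlocking`) of the
level-`0` spread «`(Lᵈ)^{k}·ν(⌊x∕L^{k}⌋)` on `L^{k}ℤᵈ`, `0` elsewhere» is the level-`j` spread «`(Lᵈ)^{k−j}·ν(⌊y∕L^{k−j}⌋)` on `L^{k−j}ℤᵈ`, `0` elsewhere», `j ≤ k`.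
[cite: Balaban1985BackgroundPropagators, (3.19) p.393] -/
theorem QprimeIter_spread (L : ℕ) [NeZero L] (T : ℕ → LSite d → LSite d → 𝔸ˣ) (hT : ∀ (j : ℕ) (y : LSite d), T j y (blockBase L y) = 1) (k : ℕ)
    (ν : LSite d → 𝔸) :
    ∀ j, j ≤ k → QprimeIter (zdBlocking d L) T j
        (fun x => if blockBase (L ^ k) (blockMap (L ^ k) x) = x then (((L : ℝ) ^ d) ^ k) • ν (blockMap (L ^ k) x) else 0)
      = fun y => if blockBase (L ^ (k - j)) (blockMap (L ^ (k - j)) y) = y then (((L : ℝ) ^ d) ^ (k - j)) • ν (blockMap (L ^ (k - j)) y) else 0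
  | 0, _ => by rw [Nat.sub_zero]; rfl
  | j + 1, hj => by
      funext y
      rw [QprimeIter_succ, QprimeIter_spread L T hT k ν j (Nat.le_of_succ_le hj)]
      have hm : k - j = (k - (j + 1)) + 1 := by omega
      rw [hm]
      exact Qprime_spread_succ L (k - (j + 1)) (T j y) y (hT j y) ν

/-- ★★ **HENCE THE CORNER SPREAD IS A PREIMAGE**: `Q′_k(spread_k ν) = ν` (the case `j = k`: scale `L⁰ = 1`, every site is a corner). [cite: Balaban1985BackgroundPropagators, (3.19) p.393] -/
theorem QprimeIter_spread_self (L : ℕ) [NeZero L] (T : ℕ → LSite d → LSite d → 𝔸ˣ) (hT : ∀ (j : ℕ) (y : LSite d), T j y (blockBase L y) = 1) (k : ℕ)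
    (ν : LSite d → 𝔸) :
    QprimeIter (zdBlocking d L) T k
        (fun x => if blockBase (L ^ k) (blockMap (L ^ k) x) = x then (((L : ℝ) ^ d) ^ k) • ν (blockMap (L ^ k) x) else 0) = ν := by
  rw [QprimeIter_spread L T hT k ν k le_rfl]
  funext y
  rw [Nat.sub_self, pow_zero, pow_zero, blockMap_one, blockBase_one, if_pos rfl, one_smul]

/-- **THE TREE'S COMB TRANSPORTERS ARE `1` AT THE BLOCK CORNERS**: `W̄ʲ(Γ_{y, L·y}) = 1` — the contour from the corner to itself is empty (`treeWord 0 = []`).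
[cite: Balaban1985Averaging, (78)–(80) p.30; Balaban1984PropagatorsI, (1.7) p.18] -/
theorem bgT_blockBase [CompleteSpace 𝔸] (L : ℕ) (U₀ : LSite d → Fin d → 𝔸ˣ) (j : ℕ) (y : LSite d) : bgT L U₀ j y (blockBase L y) = 1 := by
  unfold bgT axialFn
  rw [sub_self, treeWord_zero, hol_nil]

omit [NormedRing 𝔸] [NormedAlgebra ℂ 𝔸] in
/-- **THE CORNER SPREAD OF A PERIODIC COARSE FUNCTION IS PERIODIC ON THE FINE LATTICE**: `ν` `N_k`-periodic ⟹ `spread_k ν` `LᵏN_k`-periodic.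
[cite: Balaban1985RegularSpaces, p.77 («Ω_j = T_η»)] -/
theorem spread_add_period {β : Type*} [AddCommGroup β] [Module ℝ β] (L : ℕ) [NeZero L] (k Nk : ℕ) {ν : LSite d → β} (hν : IsPeriodic Nk ν) :
    IsPeriodic (L ^ k * Nk)
      (fun x => if blockBase (L ^ k) (blockMap (L ^ k) x) = x then (((L : ℝ) ^ d) ^ k) • ν (blockMap (L ^ k) x) else 0) := by
  intro x m
  have hL : ((L : ℤ) ^ k) ≠ 0 := pow_ne_zero _ (by exact_mod_cast NeZero.ne L)
  -- `⌊(x + LᵏN_k·m)∕Lᵏ⌋ = ⌊x∕Lᵏ⌋ + N_k·m` and `Lᵏ·(q + N_k·m) = Lᵏ·q + LᵏN_k·m`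
  have hmap : blockMap (L ^ k) (x + ((L ^ k * Nk : ℕ) : ℤ) • m) = blockMap (L ^ k) x + ((Nk : ℕ) : ℤ) • m := by
    funext i
    simp only [blockMap, Pi.add_apply, Pi.smul_apply, smul_eq_mul, Nat.cast_pow, Nat.cast_mul]
    rw [show (L : ℤ) ^ k * (Nk : ℤ) * m i = (Nk : ℤ) * m i * (L : ℤ) ^ k by ring, Int.add_mul_ediv_right _ _ hL]
  have hbase : ∀ q : LSite d, blockBase (L ^ k) (q + ((Nk : ℕ) : ℤ) • m) = blockBase (L ^ k) q + ((L ^ k * Nk : ℕ) : ℤ) • m := fun q => by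
    funext i
    simp only [blockBase, Pi.add_apply, Pi.smul_apply, smul_eq_mul, Nat.cast_pow, Nat.cast_mul]
    ring
  show (if blockBase (L ^ k) (blockMap (L ^ k) (x + _)) = x + _ then _ else _) = (if blockBase (L ^ k) (blockMap (L ^ k) x) = x then _ else _)
  rw [hmap, hbase, hν]
  by_cases hc : blockBase (L ^ k) (blockMap (L ^ k) x) = x
  · rw [if_pos hc, if_pos (by rw [hc])]
  · rw [if_neg hc, if_neg (fun h => hc (add_right_cancel h))]

end Spread

/-! ## §2 «Q′ onto» for `QprimeCombL2` -/

section Onto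

variable {F : T3Family} {n K : ℕ} {c₀ : ℝ}

/-- A `N`-PERIODIC `ℤᵈ` FUNCTION IS THE BASED PULLBACK OF ITS TORUS DESCENT: with `λ x := μ (tlift (x − y))`, `λ (y + z) = μ z` for every `z ∈ ℤᵈ`.
[cite: Balaban1985RegularSpaces, (1.3) p.77, p.77 («Ω_j = T_η»)] -/
theorem comp_transl_descend {P : Params} {j : ℕ} {β : Type*} (y : Site P j) {μ : LSite P.d → β} (hμ : IsPeriodic (P.sitesPerDir j) μ) (z : LSite P.d) :
    μ (tlift (fun κ => transl y z κ - y κ)) = μ z := by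
  have h : (fun κ => transl y z κ - y κ) = tcls (P.sitesPerDir j) z := by
    funext κ; simp [transl, tcls_apply]
  rw [h]
  obtain ⟨m, hm⟩ := (tcls_eq_tcls_iff (T := P.sitesPerDir j)).1 (tcls_tlift (T := P.sitesPerDir j) (tcls (P.sitesPerDir j) z))
  conv_rhs => rw [hm]
  exact (hμ _ m).symm

/-- ★★★ **«Q′ ONTO» FOR THE PRINT-LITERAL COMB SITE AVERAGING ON THE MEMBER'S `L²` SPACE** ([B9] (3.19) ∕ Thm 3.11's «obvious» clause, [B5] p. 25 «Q′*ω = 0, hence ω = 0»): every function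
on the coarse torus `T^{(k)}` is `QprimeCombL2 W v` for some gauge parameter `v` — at EVERY background `W` (no regularity: only the corner transporters `W̄ʲ(Γ_{y,Ly}) = 1` enter).
Preimage: the torus descent of the corner spread of `y ↦ g(y mod N_k)`. [cite: Balaban1985BackgroundPropagators, (3.19) p.393, Thm 3.11 p.416; Balaban1984PropagatorsI, p.25] -/
theorem QprimeCombL2_surjective (hnK : n ≤ K) (W : GaugeField (F.P K) 0 (Matrix.specialUnitaryGroup (Fin 2) ℂ)) :
    Function.Surjective (QprimeCombL2 F n K c₀ W) := by
  intro g
  haveI : NeZero (F.P K).L := ⟨by have h := F.hL.2; show F.L ≠ 0; omega⟩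
  -- the coarse target read on `ℤ³`, `N_k`-periodic
  have hν : IsPeriodic ((F.P K).sitesPerDir (K - n)) (fun y : LSite (F.P K).d => g (tcls ((F.P K).sitesPerDir (K - n)) y)) := fun y m => by
    show g (tcls _ (y + _)) = g (tcls _ y)
    rw [tcls_add, tcls_period, add_zero]
  -- its corner spread, `N₀ = LᵏN_k`-periodic, descended to the fine torus
  have hμ := spread_add_period (d := (F.P K).d) (F.P K).L (K - n) ((F.P K).sitesPerDir (K - n)) hν
  rw [← sitesPerDir_zero_eq F n K hnK] at hμ
  refine ⟨toL2S F K c₀ (fun x => (fun x' => if blockBase ((F.P K).L ^ (K - n)) (blockMap ((F.P K).L ^ (K - n)) x') = x'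
      then ((((F.P K).L : ℝ) ^ (F.P K).d) ^ (K - n)) • g (tcls ((F.P K).sitesPerDir (K - n)) (blockMap ((F.P K).L ^ (K - n)) x')) else 0)
    (tlift (fun κ => x κ - basePt F n K κ))), ?_⟩
  funext y
  rw [QprimeCombL2_apply, LinearEquiv.symm_apply_apply]
  have hl := funext fun z => comp_transl_descend (basePt F n K) hμ z
  rw [hl, QprimeIter_spread_self (F.P K).L _ (bgT_blockBase (F.P K).L _) (K - n) (fun y' => g (tcls ((F.P K).sitesPerDir (K - n)) y'))]
  show g (tcls ((F.P K).sitesPerDir (K - n)) (tlift y)) = g y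
  rw [tcls_tlift]

end Onto

end Summit.QuantumFields.YangMills.Theorems.Prop7QprimeCombL2

end
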